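import Summits.QuantumFields.BalabanUV.Beta.SecondOrderUnits
import Summits.QuantumFields.BalabanUV.Beta.GAN24.StencilSlotOfShapes
import Literature.MathematicalPhysics.QuantumFieldTheory.Balaban1983to89.Beta.AveragingMixedJetTables

/-!
# `BalabanUV.Beta.GAN24.T2SlotUnits` — binder row G-an2-4 / (CONV-C), the W-slot's `S₂ = T₂` table slot IN THE ADOPTED UNITS:
# an2's RECURSIVE bi-stencil family `BalabanStepW2.T2Of` normalised by `SecondOrderUnits.unitS₂ (sfStep Lc j) (smStep d Lc j)` —
# (U-T2-B) the border piece is `j`-FREE, (U-T2-V) the value piece carries the `j`-FREE scalar `cE₂·Lc^{2(d+1)}` in front of the value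
# 4-jet carrier of the NORMALISED step-`j` data, (T2-REC) the normalised recursion

NOT IN PRINT; OUR BOOKKEEPING (G-an2-4 formalisation swarm, idle leaf seat `b2b-balaban-gan24-formalise-leaf-19`, gen 17; module name
PROVISIONAL — the row owner gan24-p1 / the (P4) author an2 may rename or re-home it).  HONEST FRAMING (cell contract, verbatim): «discharging
`BetaPertH` makes Bałaban's UV stability UNCONDITIONAL — a real constructive-QFT result; it is NOT the continuum limit and NOT the Clay problem.»
HONEST DEPENDENCY (verbatim): «continuum YM on T⁴ ⇐ BetaPertH ∧ nine spine estimates (0/9 proved); BetaPertH ⇐ (D1) ∧ (D4) ∧ CAP+tail;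
G-an2-4 gates asym, D1 and NE2/3/4.»  [folklore] exponent arithmetic and packaging over the tree's own definitions — an4's
`SecondOrderUnits` (`unitS₂`, `unitM`, `unitM₂`, `mmRead_K3OfK_unit`, `unitW_W2SymOfK`), an2's `BalabanStepW2` (`wV4`, `wB2`, `e4OfW`, `K3OfK`,
`T2Of`, `Spure`, `M1`, `M2Of`), an1's `AveragingMixedJetTables.vh₂S` / `biLoc_vh₂S`, gan24-p1's `StencilSlotVH` / `StencilSlotOfShapes`, the
K-slot units `GAN24.CombesThomas.sfStep/smStep` — all BY NAME; no estimate beyond an1's own table bound, no cited fact, no `def`, no `Prop`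
mirror, 0 sorry.  It asserts NO shape of Bałaban's tables: «T2Shape» (the `j`-uniform `LocStencil₂` locality of the normalised bi-stencil
family), «T2SupRate», «T2Drift» stay LOCATED / OPEN; nothing of the wall's `(hW, hWall)` is discharged; 0 wall binders instantiated; NOT
«W-slot closed», NEVER «G-an2-4 closed»; NOT `BetaPertH`, NOT continuum, NOT Clay.

WHY.  leaf-07's `GAN24/WSlotOfShapes.hW_of_shapes` proves the wall's UNIFORM second-order binder `hW` for an2's family `WbalOf … T₂ …` from
the K-slot, «E3Shape», the mixed-table shape and ONE located shape «T2Shape» on the NORMALISED bi-stencil tables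
`unitS₂ (sfStep Lc j) (smStep d Lc j) (T₂ j)`.  For an2's Stage-B instantiation `T₂ := T2Of …` (`BalabanStepW2` §6) member `j+1` is
`(cE₂·wV4 (j+1)) • e4OfW j (Spure j) (M1 j) (WbalOf … T2Of … j) + (cB·wB2 (j+1)) • (mfNeg ∘ vh₂S)` with an2's PROVISIONAL weights
`wV4 j = (Lc^j)^{4(d+2)}`, `wB2 j = (Lc^j)^{3(d+2)}` ((P6′)).  This file settles, in the kernel, the two exponent counts these numerals
must pass against the K-slot units `(s_f, s_m) = (Lc^j, Lc^{j(d+1)})` (the `S₂`-slot twins of gan24-p1's (U-S1) `unitS_vhPiece_eq` and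
leaf-07's (U-W) `unitM_M1_eq` / `unitM₂_M2Of_eq`), and writes the normalised family as ONE `j`-INDEPENDENT recursion driven by the
normalised `(K, S, M, M₂)` data:
* (U-T2-B) `unitS₂` on an OFF-DIAGONAL (field–multiplier) table multiplies by `(s_f s_m)⁻¹·(s_f s_m)⁻¹·(s_f⁻¹ s_m⁻¹) = (Lc^j)^{−3(d+2)}`,
  which `wB2 j` cancels EXACTLY: the normalised border piece is `cB • (mfNeg ∘ vh₂S)` for EVERY `j` (an1's packer `packVH` is off-diagonal
  by definition), hence uniformly `LocStencil₂` by an1's `biLoc_vh₂S` (any rate `δ ≥ 0`, one `j`-free constant);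
* (U-T2-V) `unitS₂` at step `j+1` on the FIELD–FIELD-valued value piece (`mmRead` reads the `mm` block into the `ff` block) multiplies by
  `(s_f′ s_m′)⁻²·s_f′⁻² = (Lc^{j+1})^{−(2d+6)}`, against `wV4 (j+1) = (Lc^{j+1})^{4(d+2)}`: residue `(Lc^{j+1})^{2(d+1)} = s_m′²`; an4's
  `mmRead_K3OfK_unit` then trades the RAW step-`j` data `(K_j, S, M, W)` for the NORMALISED data at the price `s_m⁻²`, and
  `s_m′² / s_m² = Lc^{2(d+1)}` is `j`-FREE: `unitS₂_{j+1} ((cE₂·wV4 (j+1)) • e4OfW j S M W) = (cE₂·Lc^{2(d+1)}) • mmRead Lc ∘ K3OfK K_j⁽¹⁾ Lc S⁽¹⁾ M⁽¹⁾ W⁽¹⁾`;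
* (T2-REC) with an4's `unitW_W2SymOfK` the normalised member `j+1` is that carrier at `W⁽¹⁾ = W2SymOfK K_j⁽¹⁾ Lc (Spure j)⁽¹⁾ (M1 j)⁽¹⁾
  (T2Of j)⁽¹⁾ (M2Of j)⁽¹⁾` plus the `j`-free border: the normalised pair `(W⁽¹⁾, T₂⁽¹⁾)` obeys one `j`-independent AFFINE recursion map —
  an2's two provisional numerals are UNIT-CONSISTENT with the K-slot units (no residual power of `Lc^j` anywhere).
The companion module `GAN24/T2SlotOfHW` turns (T2-REC) into «T2Shape» (members `≥ 1`) ⇐ `hW` with constants first, exhibiting the loop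
«T2Shape» ⇒ `hW` (leaf-07) ⇒ «T2Shape» whose rate maps degrade (`m ↦ m/16`, `m ↦ m/128`) — the located obstruction of the W-slot's uniform half.

## What is proved (generic `d`; `Lc` with `NeZero Lc`)
* §0 `unitS₂` bookkeeping: `unitS₂_apply`, `unitS₂_step_zero`, `unitS₂_add`, `unitS₂_smul_offDiag`, `unitS₂_smul_ffOnly`.
* §1 (U-T2-B): `b2_unit_factor`, **`unitS₂_border_eq`** (generic off-diagonal border binder), `vh₂S_inl_inl` / `vh₂S_inr_inr`,
  **`unitS₂_border_vh₂S_eq`** (an1's table: `= fun κ u κ′ u′ ↦ cB • mfNeg (vh₂S d Lc κ u κ′ u′)`, every `j`), `locStencil₂_vh₂S`,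
  **`locStencil₂_unitS₂_border`** (ONE `j`-free constant `|cB|·vh2Abs·e^{6(d+1)Lc·δ}` at any rate `δ ≥ 0`).
* §2 (U-T2-V): `v4_unit_factor`, `smStep_succ_sq_div`, **`unitS₂_value_eq`**.
* §3 (T2-REC): `unitS₂_T2Of_zero`, **`unitS₂_T2Of_succ`**.
-/

noncomputable section

open Literature.MathematicalPhysics.QuantumFieldTheory
open Literature.MathematicalPhysics.QuantumFieldTheory.Balaban1983to89
open Literature.MathematicalPhysics.QuantumFieldTheory.Balaban1983to89.Beta
open ExpKernelCalculus (MKer Decays BiLoc VertexFamily VertexFamily₂)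
open OneStepResolventKernel (Fib LocStencil)
open OneStepKernelFamily (KInvStep)
open StepJetData (mfNeg mfNeg_inl_inl mfNeg_inr_inr)
open BalabanStepJetsSucc (mmRead mmRead_inl_inl mmRead_inr_left mmRead_inr_right)
open BalabanCompositeJets (LocStencil₂)
open SecondOrderResponse (W2SymOfK)
open BalabanStepW2 (wV4 wB2 Spure M1 M2Of WbalOf K3OfK e4OfW T2Of T2Of_zero T2Of_succ locStencil₂_smul' locStencil₂_mfNeg)
open WilsonBiStencil (wilsonW₂)
open AveragingMixedJetTables (vh₂S vh2Abs biLoc_vh₂S)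
open Summit.QuantumFields.BalabanUV.Beta.HessKerDressedUnits (unitK unitS unitW legScale unitS_apply legScale_inl legScale_inr legScale_one)
open Summit.QuantumFields.BalabanUV.Beta.SecondOrderUnits (unitM unitS₂ unitM₂ mmRead_K3OfK_unit unitW_W2SymOfK)
open Summit.QuantumFields.BalabanUV.Beta.GAN24.CombesThomas (sfStep smStep sfStep_ne_zero smStep_ne_zero)
open Summit.QuantumFields.BalabanUV.Beta.GAN24.StencilSlotOfShapes (sfStep_zero smStep_zero)

namespace Summit.QuantumFields.BalabanUV.Beta.GAN24.T2SlotUnits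

variable {d : ℕ} {Lc : ℕ} [NeZero Lc]

/-! ## §0 Bookkeeping for the bi-table change of units `unitS₂` -/

section Generic

variable {d : ℕ}

/-- [folklore] Entries of the rescaled bi-stencil table: `(s_f s_m)⁻¹ · (s_f s_m)⁻¹ · D⁻¹(a) · S₂ · D⁻¹(b)`. -/
theorem unitS₂_apply (sf sm : ℝ)
    (S₂ : Fin (d + 1) → (Fin (d + 1) → ℤ) → Fin (d + 1) → (Fin (d + 1) → ℤ) → MKer (d + 1) (Fib d))
    (κ : Fin (d + 1)) (u : Fin (d + 1) → ℤ) (κ' : Fin (d + 1)) (u' x z : Fin (d + 1) → ℤ) (a b : Fib d) :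
    unitS₂ sf sm S₂ κ u κ' u' x z a b =
      (sf * sm)⁻¹ * ((sf * sm)⁻¹ * (legScale sf⁻¹ sm⁻¹ a * S₂ κ u κ' u' x z a b * legScale sf⁻¹ sm⁻¹ b)) := rfl

/-- [folklore] In unit `1` the bi-table is unchanged. -/
theorem unitS₂_one (S₂ : Fin (d + 1) → (Fin (d + 1) → ℤ) → Fin (d + 1) → (Fin (d + 1) → ℤ) → MKer (d + 1) (Fib d)) :
    unitS₂ 1 1 S₂ = S₂ := by
  funext κ u κ' u' x z a b
  rw [unitS₂_apply, inv_one, legScale_one, legScale_one]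
  simp only [mul_one, inv_one, one_mul]

/-- [folklore] `unitS₂` is additive in the table. -/
theorem unitS₂_add (sf sm : ℝ)
    (A B : Fin (d + 1) → (Fin (d + 1) → ℤ) → Fin (d + 1) → (Fin (d + 1) → ℤ) → MKer (d + 1) (Fib d)) :
    unitS₂ sf sm (fun κ u κ' u' => A κ u κ' u' + B κ u κ' u') =
      fun κ u κ' u' => unitS₂ sf sm A κ u κ' u' + unitS₂ sf sm B κ u κ' u' := by
  funext κ u κ' u' x z a b
  simp only [unitS₂_apply, Pi.add_apply]
  ring

/-- [folklore] **`unitS₂` ON AN OFF-DIAGONAL (field–multiplier / multiplier–field) TABLE IS A SCALAR**: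
`(s_f s_m)⁻¹·(s_f s_m)⁻¹·(s_f⁻¹ s_m⁻¹)` — three factors `(s_f s_m)⁻¹` (the bi-table twin of gan24-p1's `StencilSlotVH.unitS_smul_offDiag`). -/
theorem unitS₂_smul_offDiag (sf sm w : ℝ)
    (B : Fin (d + 1) → (Fin (d + 1) → ℤ) → Fin (d + 1) → (Fin (d + 1) → ℤ) → MKer (d + 1) (Fib d))
    (hff : ∀ κ u κ' u' x z (α β : Fin (d + 1)), B κ u κ' u' x z (Sum.inl α) (Sum.inl β) = 0)
    (hmm : ∀ κ u κ' u' x z (μ ν : Fin (d + 1)), B κ u κ' u' x z (Sum.inr μ) (Sum.inr ν) = 0) :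
    unitS₂ sf sm (fun κ u κ' u' => w • B κ u κ' u') =
      fun κ u κ' u' => ((sf * sm)⁻¹ * (sf * sm)⁻¹ * (sf⁻¹ * sm⁻¹) * w) • B κ u κ' u' := by
  funext κ u κ' u' x z a b
  simp only [unitS₂_apply, Pi.smul_apply, smul_eq_mul]
  rcases a with α | μ <;> rcases b with β | ν
  · rw [hff]; ring
  · rw [legScale_inl, legScale_inr]; ring
  · rw [legScale_inr, legScale_inl]; ring
  · rw [hmm]; ring

/-- [folklore] **`unitS₂` ON A FIELD–FIELD-VALUED TABLE IS A SCALAR**: `(s_f s_m)⁻¹·(s_f s_m)⁻¹·(s_f⁻¹ s_f⁻¹)`. -/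
theorem unitS₂_smul_ffOnly (sf sm w : ℝ)
    (X : Fin (d + 1) → (Fin (d + 1) → ℤ) → Fin (d + 1) → (Fin (d + 1) → ℤ) → MKer (d + 1) (Fib d))
    (hfm : ∀ κ u κ' u' x z (α μ : Fin (d + 1)), X κ u κ' u' x z (Sum.inl α) (Sum.inr μ) = 0)
    (hmf : ∀ κ u κ' u' x z (μ α : Fin (d + 1)), X κ u κ' u' x z (Sum.inr μ) (Sum.inl α) = 0)
    (hmm : ∀ κ u κ' u' x z (μ ν : Fin (d + 1)), X κ u κ' u' x z (Sum.inr μ) (Sum.inr ν) = 0) :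
    unitS₂ sf sm (fun κ u κ' u' => w • X κ u κ' u') =
      fun κ u κ' u' => ((sf * sm)⁻¹ * (sf * sm)⁻¹ * (sf⁻¹ * sf⁻¹) * w) • X κ u κ' u' := by
  funext κ u κ' u' x z a b
  simp only [unitS₂_apply, Pi.smul_apply, smul_eq_mul]
  rcases a with α | μ <;> rcases b with β | ν
  · rw [legScale_inl, legScale_inl]; ring
  · rw [hfm]; ring
  · rw [hmf]; ring
  · rw [hmm]; ring

end Generic

omit [NeZero Lc] in
/-- [folklore] At step `0` the units are `1`: the bi-table is unchanged. -/
theorem unitS₂_step_zero (S₂ : Fin (d + 1) → (Fin (d + 1) → ℤ) → Fin (d + 1) → (Fin (d + 1) → ℤ) → MKer (d + 1) (Fib d)) :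
    unitS₂ (sfStep Lc 0) (smStep d Lc 0) S₂ = S₂ := by
  rw [sfStep_zero, smStep_zero, unitS₂_one]

/-! ## §1 (U-T2-B) The border piece of `T2Of` is `j`-FREE in the adopted units -/

/-- [folklore] **(U-T2-B) EXPONENT CHECK**: `(s_f s_m)⁻¹·(s_f s_m)⁻¹·(s_f⁻¹ s_m⁻¹)·wB2 j = 1` at `(s_f, s_m) = (Lc^j, Lc^{j(d+1)})` — the count
`−3j(d+2) + 3j(d+2) = 0`. -/
theorem b2_unit_factor (j : ℕ) :
    (sfStep Lc j * smStep d Lc j)⁻¹ * (sfStep Lc j * smStep d Lc j)⁻¹ * ((sfStep Lc j)⁻¹ * (smStep d Lc j)⁻¹) * wB2 d Lc j = 1 := by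
  have hL : (Lc : ℝ) ≠ 0 := Nat.cast_ne_zero.2 (NeZero.ne Lc)
  have h1 : sfStep Lc j * smStep d Lc j * (sfStep Lc j * smStep d Lc j) * (sfStep Lc j * smStep d Lc j) = wB2 d Lc j := by
    simp only [sfStep, smStep, wB2, ← pow_add, ← pow_mul]
    ring_nf
  have hne : sfStep Lc j * smStep d Lc j * (sfStep Lc j * smStep d Lc j) * (sfStep Lc j * smStep d Lc j) ≠ 0 := by
    rw [h1]; simp only [wB2]; exact pow_ne_zero _ (pow_ne_zero _ hL)
  rw [← h1, ← mul_inv, ← mul_inv, ← mul_inv]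
  exact inv_mul_cancel₀ hne

/-- [folklore] **THE NORMALISED BORDER PIECE IS `j`-INDEPENDENT** for any OFF-DIAGONAL border binder `B` (field–field and multiplier–multiplier
blocks zero): `unitS₂ (sfStep Lc j) (smStep d Lc j) (fun … ↦ (cB·wB2 j) • B …) = fun … ↦ cB • B …`, every `j`. -/
theorem unitS₂_border_eq (cB : ℝ)
    (B : Fin (d + 1) → (Fin (d + 1) → ℤ) → Fin (d + 1) → (Fin (d + 1) → ℤ) → MKer (d + 1) (Fib d))
    (hff : ∀ κ u κ' u' x z (α β : Fin (d + 1)), B κ u κ' u' x z (Sum.inl α) (Sum.inl β) = 0)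
    (hmm : ∀ κ u κ' u' x z (μ ν : Fin (d + 1)), B κ u κ' u' x z (Sum.inr μ) (Sum.inr ν) = 0) (j : ℕ) :
    unitS₂ (sfStep Lc j) (smStep d Lc j) (fun κ u κ' u' => (cB * wB2 d Lc j) • B κ u κ' u') =
      fun κ u κ' u' => cB • B κ u κ' u' := by
  rw [unitS₂_smul_offDiag _ _ _ B hff hmm]
  have e : (sfStep Lc j * smStep d Lc j)⁻¹ * (sfStep Lc j * smStep d Lc j)⁻¹ * ((sfStep Lc j)⁻¹ * (smStep d Lc j)⁻¹)
      * (cB * wB2 d Lc j) = cB := by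
    calc (sfStep Lc j * smStep d Lc j)⁻¹ * (sfStep Lc j * smStep d Lc j)⁻¹ * ((sfStep Lc j)⁻¹ * (smStep d Lc j)⁻¹)
          * (cB * wB2 d Lc j)
        = ((sfStep Lc j * smStep d Lc j)⁻¹ * (sfStep Lc j * smStep d Lc j)⁻¹ * ((sfStep Lc j)⁻¹ * (smStep d Lc j)⁻¹)
            * wB2 d Lc j) * cB := by ring
      _ = cB := by rw [b2_unit_factor, one_mul]
  rw [e]

/-- [folklore] an1's `T₂` border table vanishes on the field–field block (its packer `packVH` does, by definition). -/
theorem vh₂S_inl_inl (L : ℕ) (κ : Fin (d + 1)) (u : Fin (d + 1) → ℤ) (κ' : Fin (d + 1)) (u' x z : Fin (d + 1) → ℤ)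
    (α β : Fin (d + 1)) : vh₂S d L κ u κ' u' x z (Sum.inl α) (Sum.inl β) = 0 := rfl

/-- [folklore] an1's `T₂` border table vanishes on the multiplier–multiplier block. -/
theorem vh₂S_inr_inr (L : ℕ) (κ : Fin (d + 1)) (u : Fin (d + 1) → ℤ) (κ' : Fin (d + 1)) (u' x z : Fin (d + 1) → ℤ)
    (μ ν : Fin (d + 1)) : vh₂S d L κ u κ' u' x z (Sum.inr μ) (Sum.inr ν) = 0 := rfl

/-- [folklore] **(U-T2-B) FOR AN1's TABLE**: in the K-slot's units the border summand of EVERY member of an2's `T2Of … (vh₂S d Lc) …`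
reads an1's bare `cB • mfNeg (vh₂S d Lc κ u κ′ u′)` — the `S₂`-slot twin of gan24-p1's (U-S1) `StencilSlotVH.unitS_vhPiece_eq`. -/
theorem unitS₂_border_vh₂S_eq (cB : ℝ) (j : ℕ) :
    unitS₂ (sfStep Lc j) (smStep d Lc j) (fun κ u κ' u' => (cB * wB2 d Lc j) • mfNeg (vh₂S d Lc κ u κ' u')) =
      fun κ u κ' u' => cB • mfNeg (vh₂S d Lc κ u κ' u') :=
  unitS₂_border_eq cB (fun κ u κ' u' => mfNeg (vh₂S d Lc κ u κ' u'))
    (fun κ u κ' u' x z α β => by rw [mfNeg_inl_inl, vh₂S_inl_inl])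
    (fun κ u κ' u' x z μ ν => by rw [mfNeg_inr_inr, vh₂S_inr_inr]) j

omit [NeZero Lc] in
/-- [folklore] an1's `T₂` border table IS a `LocStencil₂` family at ANY rate `δ ≥ 0`, constant `vh2Abs·e^{6(d+1)Lc·δ}` (`biLoc_vh₂S`, verbatim). -/
theorem locStencil₂_vh₂S (hLc : 1 ≤ Lc) {δ : ℝ} (hδ : 0 ≤ δ) :
    LocStencil₂ (vh₂S d Lc) (vh2Abs (0 : Fin (d + 1) → ℤ) Lc * Real.exp (6 * ((d : ℝ) + 1) * Lc * δ)) δ :=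
  fun κ u κ' u' => biLoc_vh₂S hLc hδ κ u κ' u'

/-- [folklore] **`j`-UNIFORM `LocStencil₂` LOCALITY OF THE NORMALISED BORDER PIECES** at any rate `δ ≥ 0`, ONE `j`-free constant
`|cB|·vh2Abs·e^{6(d+1)Lc·δ}` — the border summand of «T2Shape» for an2's Stage-B family, UNCONDITIONAL. -/
theorem locStencil₂_unitS₂_border (hLc : 1 ≤ Lc) (cB : ℝ) {δ : ℝ} (hδ : 0 ≤ δ) (j : ℕ) :
    LocStencil₂ (unitS₂ (sfStep Lc j) (smStep d Lc j) (fun κ u κ' u' => (cB * wB2 d Lc j) • mfNeg (vh₂S d Lc κ u κ' u')))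
      (|cB| * (vh2Abs (0 : Fin (d + 1) → ℤ) Lc * Real.exp (6 * ((d : ℝ) + 1) * Lc * δ))) δ := by
  rw [unitS₂_border_vh₂S_eq]
  exact locStencil₂_smul' cB (locStencil₂_mfNeg (locStencil₂_vh₂S hLc hδ))

/-! ## §2 (U-T2-V) The value piece of `T2Of (j+1)` in the adopted units: a `j`-FREE scalar in front of the normalised carrier -/

/-- [folklore] **(U-T2-V) EXPONENT CHECK**: `(s_f s_m)⁻¹·(s_f s_m)⁻¹·(s_f⁻¹ s_f⁻¹)·wV4 j = s_m²` at `(s_f, s_m) = (Lc^j, Lc^{j(d+1)})` — the count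
`4j(d+2) − 2j(d+2) − 2j = 2j(d+1)`. -/
theorem v4_unit_factor (j : ℕ) :
    (sfStep Lc j * smStep d Lc j)⁻¹ * (sfStep Lc j * smStep d Lc j)⁻¹ * ((sfStep Lc j)⁻¹ * (sfStep Lc j)⁻¹) * wV4 d Lc j
      = smStep d Lc j * smStep d Lc j := by
  have hL : (Lc : ℝ) ≠ 0 := Nat.cast_ne_zero.2 (NeZero.ne Lc)
  have h1 : sfStep Lc j * smStep d Lc j * (sfStep Lc j * smStep d Lc j) * (sfStep Lc j * sfStep Lc j)
      * (smStep d Lc j * smStep d Lc j) = wV4 d Lc j := by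
    simp only [sfStep, smStep, wV4, ← pow_add, ← pow_mul]
    ring_nf
  have hne : sfStep Lc j * smStep d Lc j * (sfStep Lc j * smStep d Lc j) * (sfStep Lc j * sfStep Lc j) ≠ 0 :=
    mul_ne_zero (mul_ne_zero (mul_ne_zero (sfStep_ne_zero j) (smStep_ne_zero j))
      (mul_ne_zero (sfStep_ne_zero j) (smStep_ne_zero j))) (mul_ne_zero (sfStep_ne_zero j) (sfStep_ne_zero j))
  rw [← h1, ← mul_inv, ← mul_inv, ← mul_inv, ← mul_assoc, inv_mul_cancel₀ hne, one_mul]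

/-- [folklore] **THE ONE-STEP RATIO OF THE MULTIPLIER UNITS IS `j`-FREE**: `s_m(j+1)² · (s_m(j)²)⁻¹ = Lc^{2(d+1)}`. -/
theorem smStep_succ_sq_div (j : ℕ) :
    smStep d Lc (j + 1) * smStep d Lc (j + 1) * (smStep d Lc j * smStep d Lc j)⁻¹ = (Lc : ℝ) ^ (2 * (d + 1)) := by
  have h1 : smStep d Lc (j + 1) * smStep d Lc (j + 1) = (Lc : ℝ) ^ (2 * (d + 1)) * (smStep d Lc j * smStep d Lc j) := by
    simp only [smStep, ← pow_add]
    ring_nf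
  rw [h1, mul_assoc, mul_inv_cancel₀ (mul_ne_zero (smStep_ne_zero j) (smStep_ne_zero j)), mul_one]

/-- [folklore] The value 4-jet carrier is FIELD–FIELD-valued (`mmRead` reads the `mm` block into the `ff` block): `(inl, inr)` entries vanish. -/
theorem e4OfW_inl_inr (j : ℕ) (S M : Fin (d + 1) → (Fin (d + 1) → ℤ) → MKer (d + 1) (Fib d))
    (W : Fin (d + 1) → (Fin (d + 1) → ℤ) → Fin (d + 1) → (Fin (d + 1) → ℤ) → MKer (d + 1) (Fib d))
    (κ : Fin (d + 1)) (u : Fin (d + 1) → ℤ) (κ' : Fin (d + 1)) (u' x z : Fin (d + 1) → ℤ) (α μ : Fin (d + 1)) :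
    e4OfW d Lc j S M W κ u κ' u' x z (Sum.inl α) (Sum.inr μ) = 0 := rfl

/-- [folklore] `(inr, ·)` entries of the value 4-jet carrier vanish. -/
theorem e4OfW_inr (j : ℕ) (S M : Fin (d + 1) → (Fin (d + 1) → ℤ) → MKer (d + 1) (Fib d))
    (W : Fin (d + 1) → (Fin (d + 1) → ℤ) → Fin (d + 1) → (Fin (d + 1) → ℤ) → MKer (d + 1) (Fib d))
    (κ : Fin (d + 1)) (u : Fin (d + 1) → ℤ) (κ' : Fin (d + 1)) (u' x z : Fin (d + 1) → ℤ) (μ : Fin (d + 1)) (b : Fib d) :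
    e4OfW d Lc j S M W κ u κ' u' x z (Sum.inr μ) b = 0 := by
  cases b <;> rfl

/-- [folklore] **(U-T2-V) THE NORMALISED VALUE PIECE OF MEMBER `j+1`** for ANY step-`j` response data `(S, M, W)` over an4's kernel
`K_j = KInvStep Lc j`: in the step-`(j+1)` units it is the `j`-FREE scalar `cE₂·Lc^{2(d+1)}` times the value 4-jet carrier
`mmRead Lc ∘ K3OfK` of the NORMALISED step-`j` data `(unitK_j K_j, unitS_j S, unitM_j M, unitW_j W)` (an4's `mmRead_K3OfK_unit`). -/
theorem unitS₂_value_eq (cE₂ : ℝ) (j : ℕ) (S M : Fin (d + 1) → (Fin (d + 1) → ℤ) → MKer (d + 1) (Fib d))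
    (W : Fin (d + 1) → (Fin (d + 1) → ℤ) → Fin (d + 1) → (Fin (d + 1) → ℤ) → MKer (d + 1) (Fib d)) :
    unitS₂ (sfStep Lc (j + 1)) (smStep d Lc (j + 1)) (fun κ u κ' u' => (cE₂ * wV4 d Lc (j + 1)) • e4OfW d Lc j S M W κ u κ' u') =
      fun κ u κ' u' => (cE₂ * (Lc : ℝ) ^ (2 * (d + 1))) •
        mmRead Lc (K3OfK (unitK (sfStep Lc j) (smStep d Lc j) (KInvStep (d := d) Lc j)) Lc
          (unitS (sfStep Lc j) (smStep d Lc j) S) (unitM (sfStep Lc j) (smStep d Lc j) M)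
          (unitW (sfStep Lc j) (smStep d Lc j) W) κ u κ' u') := by
  rw [unitS₂_smul_ffOnly _ _ _ (fun κ u κ' u' => e4OfW d Lc j S M W κ u κ' u') (e4OfW_inl_inr j S M W)
    (fun κ u κ' u' x z μ α => e4OfW_inr j S M W κ u κ' u' x z μ (Sum.inl α))
    (fun κ u κ' u' x z μ ν => e4OfW_inr j S M W κ u κ' u' x z μ (Sum.inr ν))]
  funext κ u κ' u'
  rw [mmRead_K3OfK_unit (N := Lc) (sfStep_ne_zero j) (smStep_ne_zero j)]
  show _ = (cE₂ * (Lc : ℝ) ^ (2 * (d + 1))) • ((smStep d Lc j * smStep d Lc j) • e4OfW d Lc j S M W κ u κ' u')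
  rw [smul_smul, ← smStep_succ_sq_div (d := d) (Lc := Lc) j]
  congr 1
  calc (sfStep Lc (j + 1) * smStep d Lc (j + 1))⁻¹ * (sfStep Lc (j + 1) * smStep d Lc (j + 1))⁻¹
        * ((sfStep Lc (j + 1))⁻¹ * (sfStep Lc (j + 1))⁻¹) * (cE₂ * wV4 d Lc (j + 1))
      = cE₂ * ((sfStep Lc (j + 1) * smStep d Lc (j + 1))⁻¹ * (sfStep Lc (j + 1) * smStep d Lc (j + 1))⁻¹
        * ((sfStep Lc (j + 1))⁻¹ * (sfStep Lc (j + 1))⁻¹) * wV4 d Lc (j + 1)) := by ring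
    _ = cE₂ * (smStep d Lc (j + 1) * smStep d Lc (j + 1)) := by rw [v4_unit_factor]
    _ = cE₂ * (smStep d Lc (j + 1) * smStep d Lc (j + 1) * (smStep d Lc j * smStep d Lc j)⁻¹)
        * (smStep d Lc j * smStep d Lc j) := by
      rw [mul_assoc cE₂, mul_assoc (smStep d Lc (j + 1) * smStep d Lc (j + 1)),
        inv_mul_cancel₀ (mul_ne_zero (smStep_ne_zero j) (smStep_ne_zero j)), mul_one]

/-! ## §3 (T2-REC) The normalised recursion of an2's Stage-B family -/

/-- [folklore] **MEMBER `0` IN UNITS**: unchanged (`(s_f, s_m) = (1, 1)` at step `0`): `cE₂ • wilsonW₂ d T + cB • (mfNeg ∘ vh₂S)`. -/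
theorem unitS₂_T2Of_zero (cE cVH cΛ cE₂ cB : ℝ) (T : Fin 4 → Fin 4 → Fin 4 → Fin 4 → ℝ)
    (vh₂S' mixFF : Fin (d + 1) → (Fin (d + 1) → ℤ) → Fin (d + 1) → (Fin (d + 1) → ℤ) → MKer (d + 1) (Fib d)) :
    unitS₂ (sfStep Lc 0) (smStep d Lc 0) (T2Of d Lc cE cVH cΛ cE₂ cB T vh₂S' mixFF 0) =
      fun κ u κ' u' => cE₂ • wilsonW₂ d T κ u κ' u' + cB • mfNeg (vh₂S' κ u κ' u') := by
  rw [unitS₂_step_zero, T2Of_zero]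

/-- [folklore] **(T2-REC) THE NORMALISED RECURSION** for an OFF-DIAGONAL border binder `B`: member `j+1` of an2's `T2Of` in the step-`(j+1)`
units is the `j`-FREE scalar `cE₂·Lc^{2(d+1)}` times the value 4-jet carrier of the NORMALISED step-`j` data — kernel `unitK_j (KInvStep Lc j)`,
first tables `unitS_j (Spure j)`, `unitM_j (M1 j)`, and the NORMALISED second-order member
`W_j⁽¹⁾ = W2SymOfK (unitK_j K_j) Lc (unitS_j (Spure j)) (unitM_j (M1 j)) (unitS₂_j (T2Of … j)) (unitM₂_j (M2Of mixFF j))` (an4's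
`unitW_W2SymOfK`: `= unitW_j (WbalOf … (T2Of …) mixFF j)`) — plus the `j`-free border `cB • (mfNeg ∘ B)`.  ONE `j`-independent affine map
`(K⁽¹⁾, S⁽¹⁾, M⁽¹⁾, M₂⁽¹⁾; T₂⁽¹⁾(j)) ↦ T₂⁽¹⁾(j+1)`. -/
theorem unitS₂_T2Of_succ (cE cVH cΛ cE₂ cB : ℝ) (T : Fin 4 → Fin 4 → Fin 4 → Fin 4 → ℝ)
    (B mixFF : Fin (d + 1) → (Fin (d + 1) → ℤ) → Fin (d + 1) → (Fin (d + 1) → ℤ) → MKer (d + 1) (Fib d))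
    (hff : ∀ κ u κ' u' x z (α β : Fin (d + 1)), B κ u κ' u' x z (Sum.inl α) (Sum.inl β) = 0)
    (hmm : ∀ κ u κ' u' x z (μ ν : Fin (d + 1)), B κ u κ' u' x z (Sum.inr μ) (Sum.inr ν) = 0) (j : ℕ) :
    unitS₂ (sfStep Lc (j + 1)) (smStep d Lc (j + 1)) (T2Of d Lc cE cVH cΛ cE₂ cB T B mixFF (j + 1)) =
      fun κ u κ' u' => (cE₂ * (Lc : ℝ) ^ (2 * (d + 1))) •
          mmRead Lc (K3OfK (unitK (sfStep Lc j) (smStep d Lc j) (KInvStep (d := d) Lc j)) Lc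
            (unitS (sfStep Lc j) (smStep d Lc j) (Spure d Lc cE cVH cΛ j)) (unitM (sfStep Lc j) (smStep d Lc j) (M1 d Lc cΛ j))
            (W2SymOfK (unitK (sfStep Lc j) (smStep d Lc j) (KInvStep (d := d) Lc j)) Lc
              (unitS (sfStep Lc j) (smStep d Lc j) (Spure d Lc cE cVH cΛ j)) (unitM (sfStep Lc j) (smStep d Lc j) (M1 d Lc cΛ j))
              (unitS₂ (sfStep Lc j) (smStep d Lc j) (T2Of d Lc cE cVH cΛ cE₂ cB T B mixFF j))
              (unitM₂ (sfStep Lc j) (smStep d Lc j) (M2Of d Lc mixFF j))) κ u κ' u')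
        + cB • mfNeg (B κ u κ' u') := by
  have h : T2Of d Lc cE cVH cΛ cE₂ cB T B mixFF (j + 1) = fun κ u κ' u' =>
      (fun κ u κ' u' => (cE₂ * wV4 d Lc (j + 1)) •
          e4OfW d Lc j (Spure d Lc cE cVH cΛ j) (M1 d Lc cΛ j)
            (W2SymOfK (KInvStep (d := d) Lc j) Lc (Spure d Lc cE cVH cΛ j) (M1 d Lc cΛ j)
              (T2Of d Lc cE cVH cΛ cE₂ cB T B mixFF j) (M2Of d Lc mixFF j)) κ u κ' u') κ u κ' u'
        + (fun κ u κ' u' => (cB * wB2 d Lc (j + 1)) • mfNeg (B κ u κ' u')) κ u κ' u' := rfl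
  rw [h, unitS₂_add, unitS₂_value_eq,
    unitS₂_border_eq cB (fun κ u κ' u' => mfNeg (B κ u κ' u')) (fun κ u κ' u' x z α β => by rw [mfNeg_inl_inl, hff])
      (fun κ u κ' u' x z μ ν => by rw [mfNeg_inr_inr, hmm]) (j + 1),
    ← unitW_W2SymOfK (N := Lc) (sfStep_ne_zero j) (smStep_ne_zero j)]

/-- [folklore] **(T2-REC) FOR AN1's BORDER TABLE `vh₂S d Lc`** (off-diagonal by definition), every `j`. -/
theorem unitS₂_T2Of_succ_vh₂S (cE cVH cΛ cE₂ cB : ℝ) (T : Fin 4 → Fin 4 → Fin 4 → Fin 4 → ℝ)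
    (mixFF : Fin (d + 1) → (Fin (d + 1) → ℤ) → Fin (d + 1) → (Fin (d + 1) → ℤ) → MKer (d + 1) (Fib d)) (j : ℕ) :
    unitS₂ (sfStep Lc (j + 1)) (smStep d Lc (j + 1)) (T2Of d Lc cE cVH cΛ cE₂ cB T (vh₂S d Lc) mixFF (j + 1)) =
      fun κ u κ' u' => (cE₂ * (Lc : ℝ) ^ (2 * (d + 1))) •
          mmRead Lc (K3OfK (unitK (sfStep Lc j) (smStep d Lc j) (KInvStep (d := d) Lc j)) Lc
            (unitS (sfStep Lc j) (smStep d Lc j) (Spure d Lc cE cVH cΛ j)) (unitM (sfStep Lc j) (smStep d Lc j) (M1 d Lc cΛ j))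
            (unitW (sfStep Lc j) (smStep d Lc j)
              (WbalOf d Lc cE cVH cΛ (T2Of d Lc cE cVH cΛ cE₂ cB T (vh₂S d Lc) mixFF) mixFF j)) κ u κ' u')
        + cB • mfNeg (vh₂S d Lc κ u κ' u') := by
  rw [unitS₂_T2Of_succ cE cVH cΛ cE₂ cB T (vh₂S d Lc) mixFF (vh₂S_inl_inl Lc) (vh₂S_inr_inr Lc) j]
  funext κ u κ' u'
  rw [show WbalOf d Lc cE cVH cΛ (T2Of d Lc cE cVH cΛ cE₂ cB T (vh₂S d Lc) mixFF) mixFF j =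
      W2SymOfK (KInvStep (d := d) Lc j) Lc (Spure d Lc cE cVH cΛ j) (M1 d Lc cΛ j)
        (T2Of d Lc cE cVH cΛ cE₂ cB T (vh₂S d Lc) mixFF j) (M2Of d Lc mixFF j) from rfl,
    unitW_W2SymOfK (N := Lc) (sfStep_ne_zero j) (smStep_ne_zero j)]

end Summit.QuantumFields.BalabanUV.Beta.GAN24.T2SlotUnits

end
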